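import Mathlib
import Literature.Analysis.FluidPDE.SelfSimilarCollapseAnsatz
import HarnessLib
/-!
# The 1-D AXIS MODEL of C^α no-swirl Euler blow-up: origin law and the exponent dictionary

HONEST FRAMING (cell ns-blowup GROUP B «PROFILE SEARCH», zone Z6 «Elgindi-type C^{1,α} no-swirl self-similar blow-up»;
human rulings D-0035/D-0074/D-0081): **1-D MODEL** (the axis model of Hou–Zhang, MMS 22 (2024) §6–§7 / Chen, arXiv:2605.15149
eq. (1D)), pen-and-paper algebra and one-variable calculus kernel-checked; not Euler, not Navier–Stokes; «violates: none —
MODEL». Nothing in this file is a statement about Navier–Stokes; the last lemma only feeds the MODEL exponent into the tree's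
`effectiveViscosity` bookkeeping (`Literature.Analysis.FluidPDE.SelfSimilarCollapseAnsatz`).

OBJECT. The self-similar profile equation of the axis model `ω_t + 2ψω_x = −(1−α)ψ_x ω`, `ψ = −∫|x−y|^α ω(y) dy`
(Chen 2026-I eq. (1D_dyn0)): for an odd profile `W` with stream function `Ψ`,
  `(c_l x + 2 Ψ(x)) W′(x) = (c_ω − (1 − α) Ψ′(x)) W(x)`.
WHAT IS KERNEL-CHECKED HERE.
* ORIGIN LAW (`axis_origin_law`): differentiating the profile equation once at `x = 0` with `W(0) = Ψ(0) = 0`, `W′(0) ≠ 0`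
  gives `c_l + 2Ψ′(0) = c_ω − (1−α)Ψ′(0)`, i.e. `c_ω = c_l + (3 − α) p` with `p := Ψ′(0)`; in Chen's normalisation
  `c_l + 2p = 2` (his (1D_normal)) this is `c_l = 2 − 2p`, `c_ω = 2 + (1−α)p` (`cl_of_normalisation`, `cω_of_normalisation`),
  the two read-offs both cell engines print (profile-eng-10 engine B1; SHEET z6 §1.3).
* THE EXPONENT DICTIONARY (pure real algebra on those read-offs; SHEET z6 §1.3bis, refuter K-READ PASS): with
  `D := −(c_ω + α c_l) = −2 − 2α − (1 − 3α) p` (`D_eq`) the physical length exponent `c_x := c_l / D` satisfies the exact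
  identity `c_x − 2/(1−3α) = (6 − 2α)/((1−3α) D)` (`cx_sub_houZhang`), hence for every COLLAPSING profile (`D > 0`) of the
  model at `α < 1/3`: `c_x > 2/(1−3α)` (`houZhang_lt_cx`: Hou–Zhang's conjectured law `2/(1−3α)` is a strict lower bound,
  attained only in the limit `D → ∞`), `c_x > 2` (`two_lt_cx`) and `c_x > 1/2` (`half_lt_cx`); collapse forces
  `p < −2(1+α)/(1−3α)` (`p_lt_of_collapse`); and for `α ≥ 1/3`, `p ≤ 0` (i.e. `W ≤ 0` on `x > 0`) there is NO collapse:
  `D ≤ 0` (`D_nonpos_of_third_le`) — the exact backing of engine B's theorem-empty control.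
* HOOK (`tendsto_effectiveViscosity_axisModel_atTop`): since `c_x > 1/2`, the tree's `tendsto_effectiveViscosity_atTop_of_half_lt`
  gives `ν_eff(t) = ν (T − t)^{1 − 2 c_x} → +∞` as `t ↑ T` for every `ν > 0` — the MODEL exponent sits on the
  diffusion-dominant side of Leray's `1/2` (CENSUS-HOOKS-Z5-Z8 H1; SELFSIM-NOGO M8).
WHAT IS NOT PROVED HERE: existence of any profile (Chen 2026-I Thm 1.2 is not restated), the sign `p < 0`, or that `D > 0`
for a given `α` (engine B1 prints `D(α)`); these enter as hypotheses. PLACEMENT: cell-own MODEL lemma next to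
`HouLuoOriginLaws` (profile-eng-5); bears on LADDER-NS N5 / zone Z6 → N1 linear core.
-/

open Filter Topology

namespace Summit.NavierStokesRegularity.OSWSelfSimilar
namespace AxisModelExponentDictionary

/-- **ORIGIN LAW of the axis-model profile equation.** If `(c_l x + 2Ψ(x)) W′(x) = (c_ω − (1−α)Ψ′(x)) W(x)` for all `x`,
`W(0) = Ψ(0) = 0`, `W′(0) ≠ 0`, and `W, W′, Ψ, Ψ′` are differentiable at `0` (`W′ = dW`, `Ψ′ = dΨ`), then
`c_l + 2Ψ′(0) = c_ω − (1−α)Ψ′(0)`. Proof: product rule at `0`, cancel `W′(0)`. [new here — MODEL] -/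
theorem axis_origin_law (α cl cω : ℝ) (W dW Ψ dΨ : ℝ → ℝ) (ddW0 ddΨ0 : ℝ)
    (hEq : ∀ x, (cl * x + 2 * Ψ x) * dW x = (cω - (1 - α) * dΨ x) * W x)
    (hW0 : W 0 = 0) (hΨ0 : Ψ 0 = 0) (hdW0 : dW 0 ≠ 0)
    (hW : HasDerivAt W (dW 0) 0) (hdW : HasDerivAt dW ddW0 0)
    (hΨ : HasDerivAt Ψ (dΨ 0) 0) (hdΨ : HasDerivAt dΨ ddΨ0 0) :
    cl + 2 * dΨ 0 = cω - (1 - α) * dΨ 0 := by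
  have hA : HasDerivAt (fun x => cl * x + 2 * Ψ x) (cl * 1 + 2 * dΨ 0) 0 :=
    ((hasDerivAt_id' (0 : ℝ)).const_mul cl).add (hΨ.const_mul 2)
  have hL : HasDerivAt (fun x => (cl * x + 2 * Ψ x) * dW x)
      ((cl * 1 + 2 * dΨ 0) * dW 0 + (cl * 0 + 2 * Ψ 0) * ddW0) 0 := hA.mul hdW
  have hB : HasDerivAt (fun x => cω - (1 - α) * dΨ x) (0 - (1 - α) * ddΨ0) 0 :=
    (hasDerivAt_const (0 : ℝ) cω).sub (hdΨ.const_mul (1 - α))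
  have hR : HasDerivAt (fun x => (cω - (1 - α) * dΨ x) * W x)
      ((0 - (1 - α) * ddΨ0) * W 0 + (cω - (1 - α) * dΨ 0) * dW 0) 0 := hB.mul hW
  have hfun : (fun x => (cl * x + 2 * Ψ x) * dW x) = fun x => (cω - (1 - α) * dΨ x) * W x := funext hEq
  rw [hfun] at hL
  have huniq := hL.unique hR
  rw [hW0, hΨ0] at huniq
  have h2 : (cl + 2 * dΨ 0) * dW 0 = (cω - (1 - α) * dΨ 0) * dW 0 := by linear_combination huniq
  exact mul_right_cancel₀ hdW0 h2

/-- Chen's normalisation `c_l + 2p = 2` (arXiv:2605.15149 (1D_normal)) gives `c_l = 2 − 2p`. [new here — MODEL] -/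
theorem cl_of_normalisation (cl p : ℝ) (hn : cl + 2 * p = 2) : cl = 2 - 2 * p := by linarith

/-- With the origin law `c_l + 2p = c_ω − (1−α)p` and the normalisation `c_l + 2p = 2`: `c_ω = 2 + (1−α)p`. [new here — MODEL] -/
theorem cω_of_normalisation (α cl cω p : ℝ) (hlaw : cl + 2 * p = cω - (1 - α) * p) (hn : cl + 2 * p = 2) :
    cω = 2 + (1 - α) * p := by linarith

/-- `D := −(c_ω + α c_l)` in the normalised read-offs: `D = −2 − 2α − (1 − 3α) p`. [new here — MODEL] -/
theorem D_eq (α p : ℝ) :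
    -((2 + (1 - α) * p) + α * (2 - 2 * p)) = -2 - 2 * α - (1 - 3 * α) * p := by ring

/-- **THE DICTIONARY IDENTITY.** For `α ≠ 1/3` and `D = −2 − 2α − (1−3α)p ≠ 0`, the physical length exponent
`c_x = c_l/D = (2 − 2p)/D` satisfies `c_x − 2/(1−3α) = (6 − 2α)/((1 − 3α) D)`. [new here — MODEL] -/
theorem cx_sub_houZhang (α p : ℝ) (hα : 1 - 3 * α ≠ 0) (hD : -2 - 2 * α - (1 - 3 * α) * p ≠ 0) :
    (2 - 2 * p) / (-2 - 2 * α - (1 - 3 * α) * p) - 2 / (1 - 3 * α)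
      = (6 - 2 * α) / ((1 - 3 * α) * (-2 - 2 * α - (1 - 3 * α) * p)) := by
  rw [div_sub_div _ _ hD hα, div_eq_div_iff (mul_ne_zero hD hα) (mul_ne_zero hα hD)]
  ring

/-- **Hou–Zhang's conjectured law is a strict lower bound on the model.** For `α < 1/3` and a collapsing profile (`D > 0`):
`2/(1−3α) < c_x`. [new here — MODEL] -/
theorem houZhang_lt_cx (α p : ℝ) (hα : α < 1 / 3) (hD : 0 < -2 - 2 * α - (1 - 3 * α) * p) :
    2 / (1 - 3 * α) < (2 - 2 * p) / (-2 - 2 * α - (1 - 3 * α) * p) := by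
  have h13 : 0 < 1 - 3 * α := by linarith
  have hid := cx_sub_houZhang α p h13.ne' hD.ne'
  have hpos : 0 < (6 - 2 * α) / ((1 - 3 * α) * (-2 - 2 * α - (1 - 3 * α) * p)) :=
    div_pos (by linarith) (mul_pos h13 hD)
  linarith

/-- For `α < 1/3` every collapsing profile of the model has `c_x > 2`. [new here — MODEL] -/
theorem two_lt_cx (α p : ℝ) (hα0 : 0 ≤ α) (hα : α < 1 / 3) (hD : 0 < -2 - 2 * α - (1 - 3 * α) * p) :
    2 < (2 - 2 * p) / (-2 - 2 * α - (1 - 3 * α) * p) := by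
  have h13 : 0 < 1 - 3 * α := by linarith
  have hle : (2 : ℝ) ≤ 2 / (1 - 3 * α) := by
    rw [le_div_iff₀ h13]; nlinarith
  exact lt_of_le_of_lt hle (houZhang_lt_cx α p hα hD)

/-- In particular `c_x > 1/2` (Leray's exponent) for every collapsing profile of the model at `0 ≤ α < 1/3`. [new here — MODEL] -/
theorem half_lt_cx (α p : ℝ) (hα0 : 0 ≤ α) (hα : α < 1 / 3) (hD : 0 < -2 - 2 * α - (1 - 3 * α) * p) :
    1 / 2 < (2 - 2 * p) / (-2 - 2 * α - (1 - 3 * α) * p) :=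
  lt_trans (by norm_num) (two_lt_cx α p hα0 hα hD)

/-- Collapse (`D > 0`) at `α < 1/3` forces `p < −2(1+α)/(1−3α)` (the profile's `Ψ′(0)` is large negative). [new here — MODEL] -/
theorem p_lt_of_collapse (α p : ℝ) (hα : α < 1 / 3) (hD : 0 < -2 - 2 * α - (1 - 3 * α) * p) :
    p < -(2 * (1 + α)) / (1 - 3 * α) := by
  have h13 : 0 < 1 - 3 * α := by linarith
  rw [lt_div_iff₀ h13]
  nlinarith

/-- **Theorem-empty control of engine B.** For `α ≥ 1/3` and `p ≤ 0` (i.e. `W ≤ 0` on `x > 0`) the model admits NO collapse: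
`D ≤ 0`. [new here — MODEL] -/
theorem D_nonpos_of_third_le (α p : ℝ) (hα : 1 / 3 ≤ α) (hp : p ≤ 0) :
    -2 - 2 * α - (1 - 3 * α) * p ≤ 0 := by nlinarith

/-- The decay rate of the profile: `β := −c_ω/c_l` equals `α + 1/c_x` whenever `c_l ≠ 0` (for `D = 0` both sides read
with Mathlib's junk division; the exactly-self-similar limit profile is `ω^θ(T, x) ∼ |x|^{−1/c_x}`). [new here — MODEL] -/
theorem beta_eq (α p : ℝ) (hcl : 2 - 2 * p ≠ 0) :
    -(2 + (1 - α) * p) / (2 - 2 * p) = α + 1 / ((2 - 2 * p) / (-2 - 2 * α - (1 - 3 * α) * p)) := by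
  rw [one_div_div, add_div' _ _ _ hcl, div_eq_div_iff hcl hcl]
  ring

/-- **HOOK to the census bookkeeping.** For every collapsing profile of the axis model at `0 ≤ α < 1/3` and every `ν > 0`, the
effective viscosity along the collapse with exponent `c_x` diverges: `ν_eff(t) = ν (T−t)^{1−2c_x} → +∞` as `t ↑ T`
(`Literature.Analysis.FluidPDE.tendsto_effectiveViscosity_atTop_of_half_lt`). MODEL exponent only; no NS statement. [new here — MODEL] -/
theorem tendsto_effectiveViscosity_axisModel_atTop (α p ν T : ℝ) (hα0 : 0 ≤ α) (hα : α < 1 / 3)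
    (hD : 0 < -2 - 2 * α - (1 - 3 * α) * p) (hν : 0 < ν) :
    Tendsto (Literature.Analysis.FluidPDE.effectiveViscosity ν
      ((2 - 2 * p) / (-2 - 2 * α - (1 - 3 * α) * p)) T) (𝓝[<] T) atTop :=
  Literature.Analysis.FluidPDE.tendsto_effectiveViscosity_atTop_of_half_lt (half_lt_cx α p hα0 hα hD) hν

end AxisModelExponentDictionary
end Summit.NavierStokesRegularity.OSWSelfSimilar
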